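import Summits.BirchSwinnertonDyer.Rank2.LevelFifteenManinDescent
import Literature.NumberTheory.EllipticCurves.PAdicLFunctionDistributionProofs
import Literature.NumberTheory.EllipticCurves.ModularSymbolsLattice
import HarnessLib

/-!
# Manin symbols on `Γ₀(15)`, III: conjugation, the real period `Ω⁺_h = 2|E₁(h)|`, and the normalised plus symbols
# `[γ0]⁺_h − [0]⁺_h = ±n₁(γ)/2`

Cell `bsd-rank2` (D-0036), seat `bsd-rank2-eng` GEN 8 (director-bsd g8, 2026-08-27T09:39:43Z). For a cusp form
`h ∈ S₂(Γ₀(15))` with REAL Fourier coefficients: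

* `conj_msymbolSL`, `conj_xval` — `conj [k]_h = [JkJ]_h` (`J = diag(−1,1)`; tree `modularSymbol_neg_eq_conj_holds`),
  so `conj x_P = x_{conjIdx P}`; `conj_E₁`, `conj_E₂` — `E₁(h) ∈ ℝ`, `E₂(h) ∈ iℝ` (certified: `e₁∘conj − e₁`,
  `e₂∘conj + e₂` are relation combinations);
* `re_mem_periodLattice` — every period has real part `n·re E₁` (`cuspSymbol_decomp`), and `E₁ ∈ Λ_h`
  (`inftySymbol_gamma0_eq_E₁`), so `realPeriods h = ℤ·re E₁` (`realPeriods_eq`) and, when `E₁ ≠ 0`,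
  `plusPeriod h = 2|re E₁|` (`plusPeriod_eq`);
* `E₁_ne_zero` — `E₁(h) ≠ 0` for `h ≠ 0` (if all periods were imaginary, `h = 0`: tree
  `eq_zero_of_forall_apply_cuspSymbol_eq_zero`);
* `normalizedPlusSymbol_sub_eq` — for `γ = (a b; c d) ∈ Γ₀(15)` with `d ≠ 0`:
  `[b/d]⁺_h − [0]⁺_h = s·n₁/2` with `s = ±1` and `2 ∣ n₁ ↔ d² ≡ 1 (mod 5)`.

THEOREMS ONLY; no `sorry`; standard axioms. PARTITION: none — r_an ≥ 2, summit axis S0; TWIN (D-0056): n/a. B1 honesty: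
period bookkeeping at level 15; no S0 motion.

References: Ju. I. Manin, *Izv. Akad. Nauk SSSR* 36 (1972) §1.6, Thm. 1.9 [Manin1972]; J. E. Cremona, *Algorithms for
modular elliptic curves* (1997) §2.1.4, §2.8 [CremonaAlgorithms1997]; B. Mazur, J. Tate, J. Teitelbaum, *Invent. Math.* 84
(1986) §I.8 [MazurTateTeitelbaum1986Invent].
-/

noncomputable section

open scoped MatrixGroups ModularForm

open CongruenceSubgroup Matrix.SpecialLinearGroup ModularGroup Complex
open Literature.NumberTheory.EllipticCurves.ModularForms

namespace Summit.BirchSwinnertonDyer.Rank2.LevelFifteen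

variable (h : CuspForm (Gamma0 15) 2)

/-! ### §1 Conjugation of M-symbols -/

/-- `conjIdx` is the class of `J (rep P) J`, bottom row `(−c, d)`. [folklore] -/
theorem conjIdx_ok : ∀ P : Fin 24, (15 : ℤ) ∣ (-repC P) * repD (conjIdx P) - repD P * repC (conjIdx P) := by
  decide

/-- `conjIdx` is an involution. [folklore] -/
theorem conjIdx_conjIdx : ∀ P : Fin 24, conjIdx (conjIdx P) = P := by decide

/-- `conj {∞, k∞}_h = {∞, k'∞}_h` for real-coefficient `h` whenever the first columns satisfy `a'/c' = −a/c`
(`{∞, −r} = conj {∞, r}`), in either sign arrangement. [cite: CremonaAlgorithms1997, §2.1.4] -/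
theorem conj_inftySymbol (hreal : ∀ n, (cuspCoeff h n).im = 0) {k k' : SL(2, ℤ)}
    (hcol : (k' 0 0 = k 0 0 ∧ k' 1 0 = -k 1 0) ∨ (k' 0 0 = -k 0 0 ∧ k' 1 0 = k 1 0)) :
    starRingEnd ℂ (inftySymbol h k) = inftySymbol h k' := by
  unfold inftySymbol
  rcases hcol with ⟨h00, h10⟩ | ⟨h00, h10⟩
  · rw [h00, h10]
    by_cases hc : k 1 0 = 0
    · simp [hc]
    · rw [if_neg hc, if_neg (neg_ne_zero.mpr hc), ← modularSymbol_neg_eq_conj_holds h hreal]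
      congr 1; push_cast; ring
  · rw [h00, h10]
    by_cases hc : k 1 0 = 0
    · simp [hc]
    · rw [if_neg hc, if_neg hc, ← modularSymbol_neg_eq_conj_holds h hreal]
      congr 1; push_cast; ring

/-- `conj [k]_h = [JkJ]_h`, `JkJ = (a, −b; −c, d)`. [cite: CremonaAlgorithms1997, §2.1.4] -/
theorem conj_msymbolSL (hreal : ∀ n, (cuspCoeff h n).im = 0) (k : SL(2, ℤ)) :
    starRingEnd ℂ (msymbolSL h k) =
      msymbolSL h ⟨!![k 0 0, -k 0 1; -k 1 0, k 1 1], by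
        have := Matrix.SpecialLinearGroup.det_coe k
        rw [Matrix.det_fin_two] at this
        rw [Matrix.det_fin_two_of]; linear_combination this⟩ := by
  rw [msymbolSL, msymbolSL, map_sub]
  congr 1
  · exact conj_inftySymbol h hreal (Or.inl ⟨rfl, rfl⟩)
  · exact conj_inftySymbol h hreal (Or.inr ⟨by simp [coe_S, Matrix.mul_apply, Fin.sum_univ_two],
      by simp [coe_S, Matrix.mul_apply, Fin.sum_univ_two]⟩)

/-- `conj x_P(h) = x_{conjIdx P}(h)`. [cite: CremonaAlgorithms1997, §2.1.4] -/
theorem conj_xval (hreal : ∀ n, (cuspCoeff h n).im = 0) (P : Fin 24) :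
    starRingEnd ℂ (xval h P) = xval h (conjIdx P) := by
  rw [xval, conj_msymbolSL h hreal, xval]
  refine msymbolSL_eq_of_row h ?_
  change (15 : ℤ) ∣ (-(rep P) 1 0) * (rep (conjIdx P)) 1 1 - (rep P) 1 1 * (rep (conjIdx P)) 1 0
  rw [rep_apply_10, rep_apply_11, rep_apply_10, rep_apply_11]
  exact conjIdx_ok P

/-- Conjugating an evaluation re-indexes the vector by `conjIdx`. [folklore] -/
theorem conj_ev (hreal : ∀ n, (cuspCoeff h n).im = 0) (u : Fin 24 → ℤ) :
    starRingEnd ℂ (ev (xval h) u) = ev (xval h) (fun i ↦ u (conjIdx i)) := by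
  unfold ev
  rw [map_sum]
  let σ : Equiv.Perm (Fin 24) := ⟨conjIdx, conjIdx, conjIdx_conjIdx, conjIdx_conjIdx⟩
  rw [← Equiv.sum_comp σ (fun i ↦ ((u (conjIdx i) : ℤ) : ℂ) * xval h i)]
  refine Finset.sum_congr rfl fun i _ ↦ ?_
  rw [map_mul, map_intCast, conj_xval h hreal]
  change _ = ((u (conjIdx (conjIdx i)) : ℤ) : ℂ) * xval h (conjIdx i)
  rw [conjIdx_conjIdx]

/-- Certificate: `e₁ ∘ conj − e₁` is a relation combination. [folklore] -/
theorem conj1Cert_ok : ∀ i : Fin 24, ((fun j ↦ e1Tab (conjIdx j)) - e1Tab) i = relComb conj1Cert2 conj1Cert3 i := by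
  decide

/-- Certificate: `e₂ ∘ conj + e₂` is a relation combination. [folklore] -/
theorem conj2Cert_ok : ∀ i : Fin 24, ((fun j ↦ e2Tab (conjIdx j)) + e2Tab) i = relComb conj2Cert2 conj2Cert3 i := by
  decide

/-- **`E₁(h)` is real**: `conj E₁ = E₁`. [cite: Manin1972, Thm. 1.9] -/
theorem conj_E₁ (hreal : ∀ n, (cuspCoeff h n).im = 0) : starRingEnd ℂ (E₁ h) = E₁ h := by
  have key : ev (xval h) ((fun j ↦ e1Tab (conjIdx j)) - e1Tab) = 0 := by
    rw [ev_congr (xval h) conj1Cert_ok]; exact ev_relComb (xval h) (xval_rel2 h) (xval_rel3 h) _ _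
  rw [ev_sub] at key
  rw [E₁, conj_ev h hreal]
  linear_combination key

/-- **`E₂(h)` is imaginary**: `conj E₂ = −E₂`. [cite: Manin1972, Thm. 1.9] -/
theorem conj_E₂ (hreal : ∀ n, (cuspCoeff h n).im = 0) : starRingEnd ℂ (E₂ h) = -E₂ h := by
  have key : ev (xval h) ((fun j ↦ e2Tab (conjIdx j)) + e2Tab) = 0 := by
    rw [ev_congr (xval h) conj2Cert_ok]; exact ev_relComb (xval h) (xval_rel2 h) (xval_rel3 h) _ _
  rw [ev_add] at key
  rw [E₂, conj_ev h hreal]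
  linear_combination key

/-- `im E₁(h) = 0`. [folklore] -/
theorem E₁_im (hreal : ∀ n, (cuspCoeff h n).im = 0) : (E₁ h).im = 0 := by
  have := congrArg Complex.im (conj_E₁ h hreal)
  rw [Complex.conj_im] at this
  linarith

/-- `re E₂(h) = 0`. [folklore] -/
theorem E₂_re (hreal : ∀ n, (cuspCoeff h n).im = 0) : (E₂ h).re = 0 := by
  have := congrArg Complex.re (conj_E₂ h hreal)
  rw [Complex.conj_re, Complex.neg_re] at this
  linarith

/-! ### §2 The period lattice, its real parts, and `Ω⁺` -/

/-- Every element of the period lattice `Λ_h` is `n₁E₁ + n₂E₂`. [cite: Manin1972, Thm. 1.9] -/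
theorem mem_periodLattice_decomp {z : ℂ} (hz : z ∈ periodLattice h) : ∃ n₁ n₂ : ℤ, z = n₁ * E₁ h + n₂ * E₂ h := by
  refine AddSubgroup.closure_induction (p := fun z _ ↦ ∃ n₁ n₂ : ℤ, z = n₁ * E₁ h + n₂ * E₂ h) ?_ ?_ ?_ ?_ hz
  · rintro _ ⟨γ, rfl⟩
    obtain ⟨n₁, n₂, hγ, -⟩ := cuspSymbol_decomp h γ
    exact ⟨n₁, n₂, hγ⟩
  · exact ⟨0, 0, by simp⟩
  · rintro x y _ _ ⟨a₁, a₂, rfl⟩ ⟨b₁, b₂, rfl⟩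
    exact ⟨a₁ + b₁, a₂ + b₂, by push_cast; ring⟩
  · rintro x _ ⟨a₁, a₂, rfl⟩
    exact ⟨-a₁, -a₂, by push_cast; ring⟩

/-- `E₁(h) ∈ Λ_h` (the period of `γ₀ = (8 1; 15 2)`). [cite: CremonaAlgorithms1997, §2.3] -/
theorem E₁_mem_periodLattice : E₁ h ∈ periodLattice h := by
  set g : SL(2, ℤ) := (⟨!![8, 1; 15, 2], by norm_num [Matrix.det_fin_two_of]⟩ : SL(2, ℤ)) with hg
  have hmem : g ∈ Gamma0 15 := Gamma0_mem.mpr (by rw [hg]; decide)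
  have hper : cuspSymbol h ⟨g, hmem⟩ ∈ periodLattice h := AddSubgroup.subset_closure ⟨⟨g, hmem⟩, rfl⟩
  rwa [cuspSymbol_eq_inftySymbol, show ((⟨g, hmem⟩ : Gamma0 15) : SL(2, ℤ)) = g from rfl, hg,
    inftySymbol_gamma0_eq_E₁] at hper

/-- **`re Λ_h = ℤ · re E₁(h)`** for real-coefficient `h`. [cite: CremonaAlgorithms1997, §2.8] -/
theorem realPeriods_eq (hreal : ∀ n, (cuspCoeff h n).im = 0) :
    realPeriods h = AddSubgroup.zmultiples (E₁ h).re := by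
  apply le_antisymm
  · rintro x ⟨z, hz, rfl⟩
    obtain ⟨n₁, n₂, rfl⟩ := mem_periodLattice_decomp h hz
    refine ⟨n₁, ?_⟩
    change n₁ • (E₁ h).re = Complex.reLm.toAddMonoidHom (↑n₁ * E₁ h + ↑n₂ * E₂ h)
    simp [E₂_re h hreal]
  · rw [AddSubgroup.zmultiples_le]
    exact ⟨E₁ h, E₁_mem_periodLattice h, rfl⟩

/-- Positive generators of the same cyclic subgroup of `ℝ` are equal. [folklore] -/
theorem eq_of_zmultiples_eq {a b : ℝ} (ha : 0 < a) (hb : 0 < b)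
    (hab : AddSubgroup.zmultiples a = AddSubgroup.zmultiples b) : a = b := by
  have h1 : a ∈ AddSubgroup.zmultiples b := hab ▸ AddSubgroup.mem_zmultiples a
  have h2 : b ∈ AddSubgroup.zmultiples a := hab.symm ▸ AddSubgroup.mem_zmultiples b
  obtain ⟨k, hk⟩ := AddSubgroup.mem_zmultiples_iff.mp h1
  obtain ⟨l, hl⟩ := AddSubgroup.mem_zmultiples_iff.mp h2
  simp only [zsmul_eq_mul] at hk hl
  have hk1 : (1 : ℝ) ≤ k := by
    have : (0 : ℝ) < k := by nlinarith
    exact_mod_cast (show (1 : ℤ) ≤ k by exact_mod_cast this)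
  have hl1 : (1 : ℝ) ≤ l := by
    have : (0 : ℝ) < l := by nlinarith
    exact_mod_cast (show (1 : ℤ) ≤ l by exact_mod_cast this)
  nlinarith

/-- **`Ω⁺_h = 2·|re E₁(h)|`** for real-coefficient `h` with `E₁(h) ≠ 0`. [cite: MazurTateTeitelbaum1986Invent, §I.8] -/
theorem plusPeriod_eq (hreal : ∀ n, (cuspCoeff h n).im = 0) (hE : E₁ h ≠ 0) :
    plusPeriod h = 2 * |(E₁ h).re| := by
  have hre : (E₁ h).re ≠ 0 := by
    intro h0; apply hE; exact Complex.ext (by simpa using h0) (by simpa using E₁_im h hreal)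
  have hpos : 0 < |(E₁ h).re| := abs_pos.mpr hre
  have hzm : realPeriods h = AddSubgroup.zmultiples (2 * |(E₁ h).re| / 2) := by
    rw [realPeriods_eq h hreal, mul_div_cancel_left₀ _ two_ne_zero]
    rcases abs_choice (E₁ h).re with habs | habs <;> rw [habs]
    rw [AddSubgroup.zmultiples_neg]
  have hex : ∃ Ω : ℝ, 0 < Ω ∧ realPeriods h = AddSubgroup.zmultiples (Ω / 2) := ⟨_, by positivity, hzm⟩
  rw [plusPeriod, dif_pos hex]
  obtain ⟨hΩ, hΩ'⟩ := hex.choose_spec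
  have := eq_of_zmultiples_eq (by positivity) (half_pos hΩ) (hzm.symm.trans hΩ')
  linarith

/-! ### §3 `E₁ ≠ 0` for `h ≠ 0`, and the normalised plus symbols -/

/-- **`E₁(h) ≠ 0` for every nonzero real-coefficient `h ∈ S₂(Γ₀(15))`**: otherwise every period is imaginary
and `h = 0` by injectivity of the real Eichler–Shimura map. [cite: Manin1972, Thm. 1.9] -/
theorem E₁_ne_zero (hreal : ∀ n, (cuspCoeff h n).im = 0) (hh : h ≠ 0) : E₁ h ≠ 0 := by
  intro hE
  apply hh
  refine eq_zero_of_forall_apply_cuspSymbol_eq_zero (N := 15) h Complex.reLm ?_ fun γ ↦ ?_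
  · intro h0; have := congrArg (fun ℓ : ℂ →ₗ[ℝ] ℝ ↦ ℓ 1) h0; simp at this
  · obtain ⟨n₁, n₂, hγ, -⟩ := cuspSymbol_decomp h γ
    change (cuspSymbol h γ).re = 0
    rw [hγ, hE]; simp [E₂_re h hreal]

/-- For `γ = (a b; c d) ∈ Γ₀(15)` with `d ≠ 0`: `{∞, b/d}_h = {∞, γ∞}_h + {∞, 0}_h` (`b/d = γ·0 = γS·∞`).
[cite: Manin1972, Prop. 1.4] -/
theorem modularSymbol_gamma_zero (γ : Gamma0 15) (hd : (γ : SL(2, ℤ)) 1 1 ≠ 0) :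
    modularSymbol h ((((γ : SL(2, ℤ)) 0 1 : ℤ) : ℚ) / (((γ : SL(2, ℤ)) 1 1 : ℤ) : ℚ)) =
      cuspSymbol h γ + modularSymbol h 0 := by
  have e : inftySymbol h ((γ : SL(2, ℤ)) * S) =
      modularSymbol h ((((γ : SL(2, ℤ)) 0 1 : ℤ) : ℚ) / (((γ : SL(2, ℤ)) 1 1 : ℤ) : ℚ)) := by
    unfold inftySymbol
    rw [mul_S_apply_10, if_neg hd]
    congr 1
    simp [coe_S, Matrix.mul_apply, Fin.sum_univ_two]
  rw [← e, inftySymbol_gamma0_mul, inftySymbol_S]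

/-- **Normalised plus symbols on `Γ₀(15)`**: for real-coefficient `h ≠ 0` and `γ = (a b; c d) ∈ Γ₀(15)` with `d ≠ 0`,
`[b/d]⁺_h − [0]⁺_h = s·n₁/2` with `s = ±1` (the sign of `re E₁`) and `2 ∣ n₁ ↔ d² ≡ 1 (mod 5)`.
[cite: MazurTateTeitelbaum1986Invent, §I.8] -/
theorem normalizedPlusSymbol_sub_eq (hreal : ∀ n, (cuspCoeff h n).im = 0) (hh : h ≠ 0) (γ : Gamma0 15)
    (hd : (γ : SL(2, ℤ)) 1 1 ≠ 0) :
    ∃ (s : ℤ) (n₁ : ℤ), (s = 1 ∨ s = -1) ∧ ((2 : ℤ) ∣ n₁ ↔ ((((γ : SL(2, ℤ)) 1 1 : ℤ) : ZMod 5)) ^ 2 = 1) ∧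
      normalizedPlusSymbol h ((((γ : SL(2, ℤ)) 0 1 : ℤ) : ℚ) / (((γ : SL(2, ℤ)) 1 1 : ℤ) : ℚ)) -
        normalizedPlusSymbol h 0 = (s * n₁ : ℝ) / 2 := by
  obtain ⟨n₁, n₂, hγ, hpar⟩ := cuspSymbol_decomp h γ
  have hE := E₁_ne_zero h hreal hh
  have hre : (E₁ h).re ≠ 0 := by
    intro h0; apply hE; exact Complex.ext (by simpa using h0) (by simpa using E₁_im h hreal)
  have hplus : ∀ r : ℚ, normalizedPlusSymbol h r = (modularSymbol h r).re / plusPeriod h := fun r ↦ by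
    rw [normalizedPlusSymbol, plusSymbol_eq_re_of h (modularSymbol_neg_eq_conj_holds h) hreal r, Complex.ofReal_re]
  rcases lt_or_gt_of_ne hre with hneg | hpos
  · refine ⟨-1, n₁, Or.inr rfl, hpar, ?_⟩
    rw [hplus, hplus, modularSymbol_gamma_zero h γ hd, hγ, plusPeriod_eq h hreal hE, abs_of_neg hneg]
    simp only [Complex.add_re, Complex.mul_re, Complex.intCast_re, Complex.intCast_im, E₂_re h hreal,
      E₁_im h hreal, mul_zero, sub_zero, zero_mul]
    field_simp
    ring
  · refine ⟨1, n₁, Or.inl rfl, hpar, ?_⟩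
    rw [hplus, hplus, modularSymbol_gamma_zero h γ hd, hγ, plusPeriod_eq h hreal hE, abs_of_pos hpos]
    simp only [Complex.add_re, Complex.mul_re, Complex.intCast_re, Complex.intCast_im, E₂_re h hreal,
      E₁_im h hreal, mul_zero, sub_zero, zero_mul]
    field_simp
    ring

end Summit.BirchSwinnertonDyer.Rank2.LevelFifteen

end
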